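import Mathlib

/-!
# Dimock, *The renormalization group according to Balaban* I, App. C "an identity": the representation
# `C_{k,r} = A_{k,r} + a_k² A_{k,r} Q_k G_{k,r} Q_kᵀ A_{k,r}` of the fluctuation covariance — PROVED as a
# finite-dimensional operator identity (Woodbury), with the positivity that makes every inverse exist

**Citation header (reproduction of PUBLISHED work; template of the Balaban lattice Yang–Mills cell).**
J. Dimock, *The renormalization group according to Balaban. I. Small fields*, Rev. Math. Phys. **25** (2013) 1330010
(= arXiv:1108.1335v2) [Dimock2013]: §2.2 "free flow" (the minimizer, `G_k`, `Δ_k`: TeX L589–636), §4.2 (the square root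
`C_k^{1/2} = π⁻¹ ∫₀^∞ r^{−1/2} C_{k,r} dr` and `C_{k,r}`, (one)–(three): L2082–2105) and Appendix C "an identity", Lemma
`\label{lion}` with its proof (L3514–3582).  TeX line numbers refer to the arXiv source held by the cell
(`inputs/files/dimock/src/1108.1335/1108.1335.tex`, 4263 lines, sha256[:16] 7382e6540dded9be).  The auxiliary operator
`B_{k,r}` is printed in J. Dimock, *… II. Large fields*, J. Math. Phys. **54** (2013) 092301 (= arXiv:1212.5562v2)
[Dimock2013BalabanII], App. C `\label{moonshine}` (z4), TeX L6590–6595 and L6676–6689.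

**What the paper prints (verbatim).**  [Dimock2013] L335–336: *"Then QQᵀ = I while QᵀQ is a projection operator onto the
range of Qᵀ which is functions constant on the cubes."*  L594–597: *"The solution involves the inverse
G_k = (−Δ + μ̄_k + a_k Q_kᵀQ_k)^{−1}"*; L631–636 (spiffy): *"= (a_k/2)‖Φ_k‖² − (a_k²/2)⟨Φ_k, Q_kG_kQ_kᵀΦ_k⟩ ≡ ½⟨Φ_k, Δ_kΦ_k⟩
where Δ_k = a_k − a_k²Q_kG_kQ_kᵀ."*  L2087–2097: *"Hence we have the operator identity. C_k^{1/2} = π⁻¹∫₀^∞ (dr/√r) C_{k,r},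
C_{k,r} = (Δ_k + (a/L²)QᵀQ + r)^{−1}  (one).  In appendix C we establish  C_{k,r} = A_{k,r} + a_k² A_{k,r} Q_k G_{k,r} Q_kᵀ
A_{k,r}  (two) where A_{k,r} = (1/(a_k+r))(I − QᵀQ) + (1/(a_k + aL^{−2} + r)) QᵀQ,  G_{k,r} = (−Δ + μ̄_k + a_k Q_kᵀQ_k −
a_k²Q_kᵀ A_{k,r} Q_k)^{−1}  (three)"*; App. C L3516–3534: *"We seek an expression for C_{k,r} = (Δ_k + (a/L²)QᵀQ + r)^{−1}.
Lemma. C_{k,r} = A_{k,r} + a_k² A_{k,r} Q_k G_{k,r} Q_kᵀ A_{k,r}  (lion) where [A_{k,r}, G_{k,r} as in (three)]"*; proof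
L3537–3582 by Gaussian integration (*"Start with exp(½⟨f, C_{k,r}f⟩) = const ∫ dΦ exp(⟨Φ,f⟩ − (a/2L²)‖QΦ‖² − (r/2)‖Φ‖²
− ½⟨Φ, Δ_kΦ⟩) … Insert the second into the first and do the integral over Φ … Here we used (a_k + r + aL^{−2}Q_kᵀQ_k)^{−1} =
A_{k,r}"* ⟦sic: `QᵀQ`, as in (three) and from `‖QΦ‖²`⟧ *"which follows since Q_kᵀQ_k is a projection."*).
[Dimock2013BalabanII] L6590–6595: *"B_{k,r} = (r/(a_k+r))(I − QᵀQ) + ((aL^{−2}+r)/(a_k + aL^{−2} + r)) QᵀQ"* and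
L6676–6689: *"Here we have used the identity a_k²A_{k,r} − a_k = … = −a_k B_{k,r}"*.

**What is reproduced here (kernel-checked, zero `sorry`).**  The lemma is a finite-dimensional operator identity once
`Δ_k` is given its printed closed form (spiffy); the Gaussian integrals of the printed proof compute exactly the
inverses that the Woodbury identity produces algebraically.  CARRIER: real matrices over arbitrary finite index types —
`κ` (the fine lattice `𝕋^{−k}`, home of `φ` and of `D := −Δ + μ̄_k`), `ι` (the unit lattice `𝕋⁰`, home of `Φ_k`, `f`),
`σ` (the next lattice `𝕋¹`, target of the one-step averaging `Q`); `Qk : Matrix ι κ ℝ` is ARBITRARY, `Q : Matrix σ ι ℝ`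
satisfies the printed `QQᵀ = I`, `D` is symmetric positive definite (−Δ + μ̄_k with μ̄_k > 0), `a_k > 0`, `aL := a/L² ≥
0`, `r ≥ 0` with `a_k + r > 0`.  PROVED: §1 the projection algebra of `P = QᵀQ` (`proj_mul_proj`, complementary
products); §2 `Akr` IS the inverse of `(a_k + r) + aL·P` (`base_mul_Akr`, `base_inv_eq_Akr` — the printed *"which
follows since QᵀQ is a projection"*) and [Dimock2013BalabanII]'s identity `1 − a_k A_{k,r} = B_{k,r}`
(`one_sub_smul_Akr`), `B_{k,r} ≥ 0` (`Bkr_posSemidef`); §3 the bracket of `G_{k,r}` equals `D + a_k Q_kᵀ B_{k,r} Q_k`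
(`gkrInv_eq`) and is positive definite (`gkrInv_posDef`) — so `G_{k,r}` exists for every `r ≥ 0`, the fact the printed
proof uses silently when it "does the integral over φ"; §4 **LEMMA (lion)** `Ckr_eq` : `C_{k,r} = A_{k,r} + a_k² A_{k,r}
Q_k G_{k,r} Q_kᵀ A_{k,r}`, by Mathlib's Woodbury identity `Matrix.add_mul_mul_inv_eq_sub` applied to
`(a_k + r) + aL·P + Q_k(−a_k² G_k)Q_kᵀ` with the three invertibilities discharged from §2–§3; `ckrInv_isUnit`
(`Δ_k + aL·P + r` is invertible under the same hypotheses, so `C_{k,r}` is a genuine inverse — `Ckr_mul_eq_one_and_eq`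
states (one) ∧ (two) together); §5 a one-site `example`; §6 (v1.1) [Dimock2013BalabanII] LEMMA 3.5 `th2`'s
ALGEBRAIC INPUT, TeX L3382–3388 verbatim *"First note that a_kQ_kᵀB_{k,r}Q_k = (a_kr/(a_k+r))Q_kᵀQ_k +
(a_k²aL^{−2}/((a_k+r)(a_k+aL^{−2}+r)))Q_{k+1}ᵀQ_{k+1} (summer) This is bounded below by O(1)L^{−2}Q_{k+1}ᵀQ_{k+1} for 0
≤ r ≤ 1 and by O(1)Q_kᵀQ_k for r ≥ 1."* — PROVED with `Q_{k+1} = QQ_k`: **`smul_conj_Bkr_eq`** ((summer)),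
**`one_sub_Bkr_posSemidef`** (`B_{k,r} ≤ I`, so `0 ≤ B_{k,r} ≤ I` with `Bkr_posSemidef`), **`gkrInv_sub_posSemidef`**∕
**`sub_gkrInv_posSemidef`** (`D ≤ D + a_kQ_kᵀB_{k,r}Q_k ≤ D + a_kQ_kᵀQ_k` for all `r ≥ 0` — the `r`-uniform comparison
of the bracket of `G_{k,r}`), **`smul_conj_Bkr_lower_of_le_one`** (`≥ (a_k²aL/((a_k+1)(a_k+aL+1)))·Q_{k+1}ᵀQ_{k+1}` for
`0 ≤ r ≤ 1`: the `O(1)L^{−2}` explicit, `aL = a/L²`), **`smul_conj_Bkr_lower_of_one_le`** (`≥ (a_k/(a_k+1))·Q_kᵀQ_k` for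
`r ≥ 1`).

**Deviations (declared).**  (i) `Δ_k` is DEFINED by its printed closed form (spiffy) `a_k − a_k² Q_k G_k Q_kᵀ`, not
through the Gaussian integral (third)/(only) from which [Dimock2013] derives it; (ii) the lattices are abstract finite
index types and `Q_k`, `Q` abstract matrices with only `QQᵀ = I` assumed (the print's `Q_k = Q^k` block averaging is an
instance); (iii) `aL` stands for `a/L²` and only `aL ≥ 0` is used; `r ≥ 0` (the print integrates over `r > 0`).

**What is NOT claimed.**  The square-root formula (one) `C_k^{1/2} = π⁻¹∫ r^{−1/2} C_{k,r} dr` and the bounds on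
`C_k^{1/2}` of §4.2 (L2190–2206); the multi-region version [Dimock2013BalabanII] App. C (z4) (`G_{k,Ω⁺,r}` with the
`[·]_{Ω}` restrictions); Lemma th2 itself ((teeny), the Neumann lower bound `≥ [−Δ + O(1)L^{−2}]_{□̃}`, the
random walk expansion and (security)); anything of B1–B16 (TEMPLATE.md §4.1 row «D1 §4.2 / App. C» maps the identity to B12 §2 and
B9 §E Thm 3.15's unit-lattice propagators, grade P).  Finite-dimensional linear algebra only; the only `[folklore]`
items are private helpers.  NOT summit progress; NOT a statement about any Bałaban paper; NOT continuum; NOT Clay.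
Unit `b2b-balaban-template` gen 28 (journal CLAIM D1-APPC-LION-KERNEL); v1.1 gen 35 (journal CLAIM D2-TH2-SUMMER: §6 added,
§1–§5 unchanged); cell records TEMPLATE.md §4.1 row «D1 §4.2 ∕ App. C», §4.2 row «D2 §3.4», GAPS C-tmpl35-3.
-/

namespace Literature.MathematicalPhysics.QuantumFieldTheory.Dimock2011to13.FluctuationCovarianceIdentity

open Matrix
open scoped Matrix

variable {ι κ σ : Type*} [Fintype ι] [Fintype κ] [Fintype σ] [DecidableEq ι] [DecidableEq κ] [DecidableEq σ]

/-! ## §1 The objects, as printed, and the projection `P = QᵀQ` -/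

/-- `P = QᵀQ`, *"a projection operator onto the range of Qᵀ which is functions constant on the cubes"* (given
`QQᵀ = I`). [cite: Dimock2013, §2.1 L335–336 (arXiv:1108.1335v2 TeX)] -/
def proj (Q : Matrix σ ι ℝ) : Matrix ι ι ℝ := Qᵀ * Q

/-- `G_k = (−Δ + μ̄_k + a_k Q_kᵀQ_k)^{−1}` with `D := −Δ + μ̄_k`. [cite: Dimock2013, §2.2 L594–597 (arXiv:1108.1335v2
TeX)] -/
noncomputable def Gk (D : Matrix κ κ ℝ) (Qk : Matrix ι κ ℝ) (ak : ℝ) : Matrix κ κ ℝ := (D + ak • (Qkᵀ * Qk))⁻¹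

/-- `Δ_k = a_k − a_k² Q_k G_k Q_kᵀ` (the printed closed form (spiffy); deviation (i) of the header).
[cite: Dimock2013, §2.2 (spiffy) L631–636 (arXiv:1108.1335v2 TeX)] -/
noncomputable def Deltak (D : Matrix κ κ ℝ) (Qk : Matrix ι κ ℝ) (ak : ℝ) : Matrix ι ι ℝ :=
  ak • (1 : Matrix ι ι ℝ) - ak ^ 2 • (Qk * Gk D Qk ak * Qkᵀ)

/-- `C_{k,r} = (Δ_k + (a/L²)QᵀQ + r)^{−1}` (`aL := a/L²`). [cite: Dimock2013, §4.2 (one) L2087–2093 and App. C L3516–3519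
(arXiv:1108.1335v2 TeX)] -/
noncomputable def Ckr (D : Matrix κ κ ℝ) (Qk : Matrix ι κ ℝ) (Q : Matrix σ ι ℝ) (ak aL r : ℝ) : Matrix ι ι ℝ :=
  (Deltak D Qk ak + aL • proj Q + r • (1 : Matrix ι ι ℝ))⁻¹

/-- `A_{k,r} = (1/(a_k+r))(I − QᵀQ) + (1/(a_k + aL^{−2} + r)) QᵀQ`. [cite: Dimock2013, §4.2 (three) L2099–2105 and App. C
L3527–3533 (arXiv:1108.1335v2 TeX)] -/
noncomputable def Akr (Q : Matrix σ ι ℝ) (ak aL r : ℝ) : Matrix ι ι ℝ :=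
  (ak + r)⁻¹ • (1 - proj Q) + (ak + aL + r)⁻¹ • proj Q

/-- `B_{k,r} = (r/(a_k+r))(I − QᵀQ) + ((aL^{−2}+r)/(a_k + aL^{−2} + r)) QᵀQ`. [cite: Dimock2013BalabanII, App. C (z4)
L6590–6595 (arXiv:1212.5562v2 TeX)] -/
noncomputable def Bkr (Q : Matrix σ ι ℝ) (ak aL r : ℝ) : Matrix ι ι ℝ :=
  (r / (ak + r)) • (1 - proj Q) + ((aL + r) / (ak + aL + r)) • proj Q

/-- the bracket of `G_{k,r}`: `−Δ + μ̄_k + a_k Q_kᵀQ_k − a_k²Q_kᵀ A_{k,r} Q_k`. [cite: Dimock2013, §4.2 (three) L2099–2105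
(arXiv:1108.1335v2 TeX)] -/
noncomputable def gkrInv (D : Matrix κ κ ℝ) (Qk : Matrix ι κ ℝ) (Q : Matrix σ ι ℝ) (ak aL r : ℝ) : Matrix κ κ ℝ :=
  D + ak • (Qkᵀ * Qk) - ak ^ 2 • (Qkᵀ * Akr Q ak aL r * Qk)

/-- `G_{k,r} = (−Δ + μ̄_k + a_k Q_kᵀQ_k − a_k²Q_kᵀ A_{k,r} Q_k)^{−1}`. [cite: Dimock2013, §4.2 (three) L2099–2105 and App. C
L3527–3533 (arXiv:1108.1335v2 TeX)] -/
noncomputable def Gkr (D : Matrix κ κ ℝ) (Qk : Matrix ι κ ℝ) (Q : Matrix σ ι ℝ) (ak aL r : ℝ) : Matrix κ κ ℝ :=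
  (gkrInv D Qk Q ak aL r)⁻¹

section ProjectionAlgebra

variable {Q : Matrix σ ι ℝ}

omit [Fintype ι] [DecidableEq ι] [DecidableEq σ] in
/-- `P` is symmetric. [folklore] -/
private theorem proj_transpose (Q : Matrix σ ι ℝ) : (proj Q)ᵀ = proj Q := by
  unfold proj
  rw [transpose_mul, transpose_transpose]

omit [DecidableEq ι] in
/-- `QQᵀ = I ⇒ P² = P` — *"QᵀQ is a projection"*. [folklore] -/
private theorem proj_mul_proj (hQ : Q * Qᵀ = 1) : proj Q * proj Q = proj Q := by
  unfold proj
  rw [Matrix.mul_assoc, ← Matrix.mul_assoc Q, hQ, Matrix.one_mul]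

/-- `P(1 − P) = 0`. [folklore] -/
private theorem proj_mul_compl (hQ : Q * Qᵀ = 1) : proj Q * (1 - proj Q) = 0 := by
  rw [Matrix.mul_sub, Matrix.mul_one, proj_mul_proj hQ, sub_self]

/-- `(1 − P)P = 0`. [folklore] -/
private theorem compl_mul_proj (hQ : Q * Qᵀ = 1) : (1 - proj Q) * proj Q = 0 := by
  rw [Matrix.sub_mul, Matrix.one_mul, proj_mul_proj hQ, sub_self]

/-- `(1 − P)² = 1 − P`. [folklore] -/
private theorem compl_mul_compl (hQ : Q * Qᵀ = 1) : (1 - proj Q) * (1 - proj Q) = 1 - proj Q := by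
  rw [Matrix.mul_sub, Matrix.mul_one, compl_mul_proj hQ, sub_zero]

omit [DecidableEq ι] [DecidableEq σ] in
/-- `P` is positive semidefinite (`P = QᵀQ`). [folklore] -/
private theorem proj_posSemidef (Q : Matrix σ ι ℝ) : (proj Q).PosSemidef := by
  have h := Matrix.posSemidef_conjTranspose_mul_self Q
  rwa [conjTranspose_eq_transpose_of_trivial] at h

/-- `1 − P` is positive semidefinite (`= (1 − P)ᵀ(1 − P)`). [folklore] -/
private theorem compl_posSemidef (hQ : Q * Qᵀ = 1) : (1 - proj Q).PosSemidef := by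
  have h := Matrix.posSemidef_conjTranspose_mul_self (1 - proj Q)
  have ht : (1 - proj Q)ᴴ = 1 - proj Q := by
    rw [conjTranspose_eq_transpose_of_trivial, transpose_sub, transpose_one, proj_transpose]
  rwa [ht, compl_mul_compl hQ] at h

end ProjectionAlgebra

/-! ## §2 `A_{k,r}` is the inverse of `a_k + r + aL·QᵀQ`; the identity `1 − a_k A_{k,r} = B_{k,r}`; `B_{k,r} ≥ 0` -/

section Akr

variable {Q : Matrix σ ι ℝ} {ak aL r : ℝ}

/-- *"(a_k + r + aL^{−2}QᵀQ)^{−1} = A_{k,r} which follows since QᵀQ is a projection"* — as the right-inverse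
equation `((a_k + r)·1 + aL·P)·A_{k,r} = 1`. [cite: Dimock2013, App. C L3559–3563 (arXiv:1108.1335v2 TeX)] -/
theorem base_mul_Akr (hQ : Q * Qᵀ = 1) (h1 : ak + r ≠ 0) (h2 : ak + aL + r ≠ 0) :
    ((ak + r) • (1 : Matrix ι ι ℝ) + aL • proj Q) * Akr Q ak aL r = 1 := by
  have hPP := proj_mul_proj hQ
  have hPc := proj_mul_compl hQ
  unfold Akr
  -- expand the product and normalise the projection words
  have hexp : ((ak + r) • (1 : Matrix ι ι ℝ) + aL • proj Q) *
        ((ak + r)⁻¹ • (1 - proj Q) + (ak + aL + r)⁻¹ • proj Q)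
      = ((ak + r) * (ak + r)⁻¹) • (1 - proj Q) +
          (((ak + r) * (ak + aL + r)⁻¹) • proj Q + (aL * (ak + aL + r)⁻¹) • proj Q) := by
    rw [Matrix.add_mul, Matrix.mul_add, Matrix.mul_add, Matrix.smul_mul, Matrix.smul_mul, Matrix.smul_mul,
      Matrix.smul_mul, Matrix.one_mul, Matrix.one_mul, Matrix.mul_smul, Matrix.mul_smul, hPc, hPP, smul_zero,
      smul_zero, zero_add, smul_smul, smul_smul, smul_smul]
    abel
  have hcoef : (ak + r) * (ak + aL + r)⁻¹ + aL * (ak + aL + r)⁻¹ = 1 := by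
    rw [← add_mul, show ak + r + aL = ak + aL + r by ring, mul_inv_cancel₀ h2]
  rw [hexp, mul_inv_cancel₀ h1, one_smul, ← add_smul, hcoef, one_smul, sub_add_cancel]

/-- hence `(a_k + r + aL·QᵀQ)` is invertible … [folklore] -/
private theorem base_isUnit (hQ : Q * Qᵀ = 1) (h1 : ak + r ≠ 0) (h2 : ak + aL + r ≠ 0) :
    IsUnit ((ak + r) • (1 : Matrix ι ι ℝ) + aL • proj Q) :=
  (Matrix.isUnit_iff_isUnit_det _).mpr (Matrix.isUnit_det_of_right_inverse (base_mul_Akr hQ h1 h2))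

/-- … with inverse `A_{k,r}`. [cite: Dimock2013, App. C L3559–3563 (arXiv:1108.1335v2 TeX)] -/
theorem base_inv_eq_Akr (hQ : Q * Qᵀ = 1) (h1 : ak + r ≠ 0) (h2 : ak + aL + r ≠ 0) :
    ((ak + r) • (1 : Matrix ι ι ℝ) + aL • proj Q)⁻¹ = Akr Q ak aL r :=
  Matrix.inv_eq_right_inv (base_mul_Akr hQ h1 h2)

omit [Fintype ι] [DecidableEq σ] in
/-- **[Dimock2013BalabanII]'s identity** *"a_k²A_{k,r} − a_k = −a_k B_{k,r}"*, in the form `1 − a_k A_{k,r} = B_{k,r}`.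
[cite: Dimock2013BalabanII, App. C L6676–6689 (arXiv:1212.5562v2 TeX)] -/
theorem one_sub_smul_Akr (h1 : ak + r ≠ 0) (h2 : ak + aL + r ≠ 0) :
    (1 : Matrix ι ι ℝ) - ak • Akr Q ak aL r = Bkr Q ak aL r := by
  unfold Akr Bkr
  ext i j
  simp only [Matrix.sub_apply, Matrix.add_apply, Matrix.smul_apply, smul_eq_mul, Matrix.one_apply]
  have e1 : 1 - ak * (ak + r)⁻¹ = r / (ak + r) := by field_simp; ring
  have e2 : 1 - ak * (ak + aL + r)⁻¹ = (aL + r) / (ak + aL + r) := by field_simp; ring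
  rw [← e1, ← e2]
  split_ifs <;> ring

omit [Fintype ι] [DecidableEq σ] in
/-- the printed form: `a_k²A_{k,r} − a_k = −a_k B_{k,r}`. [cite: Dimock2013BalabanII, App. C L6676–6689
(arXiv:1212.5562v2 TeX)] -/
theorem sq_smul_Akr_sub (h1 : ak + r ≠ 0) (h2 : ak + aL + r ≠ 0) :
    ak ^ 2 • Akr Q ak aL r - ak • (1 : Matrix ι ι ℝ) = -(ak • Bkr Q ak aL r) := by
  rw [← one_sub_smul_Akr h1 h2, smul_sub, smul_smul, ← pow_two]
  abel

/-- `B_{k,r} ≥ 0` for `a_k > 0`, `aL ≥ 0`, `r ≥ 0` (nonnegative combination of the complementary projections).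
[cite: Dimock2013BalabanII, App. C (z4) L6590–6595 (arXiv:1212.5562v2 TeX)] -/
theorem Bkr_posSemidef (hQ : Q * Qᵀ = 1) (hak : 0 < ak) (haL : 0 ≤ aL) (hr : 0 ≤ r) :
    (Bkr Q ak aL r).PosSemidef := by
  unfold Bkr
  refine Matrix.PosSemidef.add ?_ ?_
  · exact (compl_posSemidef hQ).smul (div_nonneg hr (by linarith))
  · exact (proj_posSemidef Q).smul (div_nonneg (by linarith) (by linarith))

end Akr

/-! ## §3 The bracket of `G_{k,r}` is `D + a_k Q_kᵀ B_{k,r} Q_k`, positive definite; `G_k`, `G_{k,r}` exist -/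

section Gkr

variable {D : Matrix κ κ ℝ} {Qk : Matrix ι κ ℝ} {Q : Matrix σ ι ℝ} {ak aL r : ℝ}

omit [Fintype κ] [DecidableEq κ] [DecidableEq σ] in
/-- `−Δ + μ̄_k + a_k Q_kᵀQ_k − a_k²Q_kᵀA_{k,r}Q_k = D + a_k Q_kᵀ B_{k,r} Q_k` (insert `1 − a_kA_{k,r} = B_{k,r}` — the step
*"− ½⟨φ, (−Δ + μ̄_k + a_k Q_kᵀB_{k,r}Q_k + …)φ⟩"* of [Dimock2013BalabanII] L6665–6670). [cite: Dimock2013BalabanII,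
App. C L6660–6675 (arXiv:1212.5562v2 TeX)] -/
theorem gkrInv_eq (h1 : ak + r ≠ 0) (h2 : ak + aL + r ≠ 0) :
    gkrInv D Qk Q ak aL r = D + ak • (Qkᵀ * Bkr Q ak aL r * Qk) := by
  unfold gkrInv
  rw [← one_sub_smul_Akr h1 h2, Matrix.mul_sub, Matrix.sub_mul, Matrix.mul_one, Matrix.mul_smul, Matrix.smul_mul,
    smul_sub, smul_smul, ← pow_two]
  abel

omit [DecidableEq κ] in
/-- **THE BRACKET OF `G_{k,r}` IS POSITIVE DEFINITE** (`D > 0`, `a_k > 0`, `aL ≥ 0`, `r ≥ 0`): so `G_{k,r}` exists for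
every `r` of the square-root integral — the existence the printed Gaussian computation uses silently.
[cite: Dimock2013, §4.2 (three) / App. C L3527–3533 (arXiv:1108.1335v2 TeX)] -/
theorem gkrInv_posDef (hD : D.PosDef) (hQ : Q * Qᵀ = 1) (hak : 0 < ak) (haL : 0 ≤ aL) (hr : 0 ≤ r) :
    (gkrInv D Qk Q ak aL r).PosDef := by
  rw [gkrInv_eq (by linarith) (by linarith)]
  refine hD.add_posSemidef ?_
  have h := (Bkr_posSemidef hQ hak haL hr).conjTranspose_mul_mul_same Qk
  rw [conjTranspose_eq_transpose_of_trivial] at h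
  exact h.smul hak.le

omit [DecidableEq ι] [DecidableEq κ] in
/-- the bracket of `G_k`, `D + a_k Q_kᵀQ_k`, is positive definite. [cite: Dimock2013, §2.2 L594–597 (arXiv:1108.1335v2
TeX)] -/
theorem gkInv_posDef (hD : D.PosDef) (hak : 0 < ak) : (D + ak • (Qkᵀ * Qk)).PosDef := by
  refine hD.add_posSemidef ?_
  have h := Matrix.posSemidef_conjTranspose_mul_self Qk
  rw [conjTranspose_eq_transpose_of_trivial] at h
  exact h.smul hak.le

end Gkr

/-! ## §4 Lemma (lion) -/

section Lion

variable {D : Matrix κ κ ℝ} {Qk : Matrix ι κ ℝ} {Q : Matrix σ ι ℝ} {ak aL r : ℝ}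

omit [DecidableEq σ] in
/-- `C_{k,r}⁻¹ = Δ_k + aL·P + r` rearranged as `((a_k + r) + aL·P) + Q_k(−a_k² G_k)Q_kᵀ` — the shape of the Woodbury
identity. [folklore] -/
private theorem ckrInv_eq :
    Deltak D Qk ak + aL • proj Q + r • (1 : Matrix ι ι ℝ)
      = ((ak + r) • (1 : Matrix ι ι ℝ) + aL • proj Q) + Qk * (-(ak ^ 2) • Gk D Qk ak) * Qkᵀ := by
  unfold Deltak
  rw [Matrix.mul_smul, Matrix.smul_mul, neg_smul, add_smul]
  abel

omit [DecidableEq ι] in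
/-- the inverse of the middle factor: `(−a_k² G_k)⁻¹ = −a_k⁻² (D + a_k Q_kᵀQ_k)`. [folklore] -/
private theorem mid_mul (hD : D.PosDef) (hak : 0 < ak) :
    (-(ak ^ 2) • Gk D Qk ak) * (-(ak ^ 2)⁻¹ • (D + ak • (Qkᵀ * Qk))) = 1 := by
  unfold Gk
  have hu : IsUnit (D + ak • (Qkᵀ * Qk)).det :=
    (Matrix.isUnit_iff_isUnit_det _).mp (gkInv_posDef (Qk := Qk) hD hak).isUnit
  have hak2 : ak ^ 2 ≠ 0 := by positivity
  rw [Matrix.smul_mul, Matrix.mul_smul, smul_smul, Matrix.nonsing_inv_mul _ hu, neg_mul_neg,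
    mul_inv_cancel₀ hak2, one_smul]

omit [DecidableEq ι] in
/-- `−a_k² G_k` is invertible. [folklore] -/
private theorem mid_isUnit (hD : D.PosDef) (hak : 0 < ak) : IsUnit (-(ak ^ 2) • Gk D Qk ak) :=
  (Matrix.isUnit_iff_isUnit_det _).mpr (Matrix.isUnit_det_of_right_inverse (mid_mul hD hak))

omit [DecidableEq ι] in
/-- `(−a_k² G_k)⁻¹ = −a_k⁻²(D + a_k Q_kᵀQ_k)`. [folklore] -/
private theorem mid_inv (hD : D.PosDef) (hak : 0 < ak) :
    (-(ak ^ 2) • Gk D Qk ak)⁻¹ = -(ak ^ 2)⁻¹ • (D + ak • (Qkᵀ * Qk)) :=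
  Matrix.inv_eq_right_inv (mid_mul hD hak)

/-- the capacitance matrix of the Woodbury identity is `−a_k⁻²·(bracket of G_{k,r})`. [folklore] -/
private theorem cap_eq (hD : D.PosDef) (hQ : Q * Qᵀ = 1) (hak : 0 < ak) (h1 : ak + r ≠ 0) (h2 : ak + aL + r ≠ 0) :
    (-(ak ^ 2) • Gk D Qk ak)⁻¹ + Qkᵀ * ((ak + r) • (1 : Matrix ι ι ℝ) + aL • proj Q)⁻¹ * Qk
      = -(ak ^ 2)⁻¹ • gkrInv D Qk Q ak aL r := by
  rw [mid_inv hD hak, base_inv_eq_Akr hQ h1 h2]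
  unfold gkrInv
  have hak2 : ak ^ 2 ≠ 0 := by positivity
  rw [smul_sub, smul_smul, neg_mul, inv_mul_cancel₀ hak2, neg_one_smul, sub_neg_eq_add]

/-- the capacitance matrix times `−a_k² G_{k,r}` is `1`. [folklore] -/
private theorem cap_mul (hD : D.PosDef) (hQ : Q * Qᵀ = 1) (hak : 0 < ak) (haL : 0 ≤ aL) (hr : 0 ≤ r) :
    (-(ak ^ 2)⁻¹ • gkrInv D Qk Q ak aL r) * (-(ak ^ 2) • Gkr D Qk Q ak aL r) = 1 := by
  unfold Gkr
  have hu : IsUnit (gkrInv D Qk Q ak aL r).det :=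
    (Matrix.isUnit_iff_isUnit_det _).mp (gkrInv_posDef hD hQ hak haL hr).isUnit
  have hak2 : ak ^ 2 ≠ 0 := by positivity
  rw [Matrix.smul_mul, Matrix.mul_smul, smul_smul, Matrix.mul_nonsing_inv _ hu, neg_mul_neg,
    inv_mul_cancel₀ hak2, one_smul]

/-- **LEMMA (lion)** (App. C of [Dimock2013]; (two) of §4.2): for `D = −Δ + μ̄_k` positive definite, `QQᵀ = I`,
`a_k > 0`, `aL = a/L² ≥ 0`, `r ≥ 0`:  `C_{k,r} = A_{k,r} + a_k² A_{k,r} Q_k G_{k,r} Q_kᵀ A_{k,r}`.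
[cite: Dimock2013, App. C Lemma (lion) (arXiv:1108.1335v2 TeX L3521–3534); §4.2 (two) L2094–2097] -/
theorem Ckr_eq (hD : D.PosDef) (hQ : Q * Qᵀ = 1) (hak : 0 < ak) (haL : 0 ≤ aL) (hr : 0 ≤ r) :
    Ckr D Qk Q ak aL r
      = Akr Q ak aL r + ak ^ 2 • (Akr Q ak aL r * Qk * Gkr D Qk Q ak aL r * Qkᵀ * Akr Q ak aL r) := by
  have h1 : ak + r ≠ 0 := by linarith
  have h2 : ak + aL + r ≠ 0 := by linarith
  have hak2 : ak ^ 2 ≠ 0 := by positivity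
  -- the three invertibilities of the Woodbury identity
  have hA := base_isUnit (ι := ι) hQ h1 h2
  have hC := mid_isUnit (Qk := Qk) hD hak
  have hcapU : IsUnit ((-(ak ^ 2) • Gk D Qk ak)⁻¹ + Qkᵀ * ((ak + r) • (1 : Matrix ι ι ℝ) + aL • proj Q)⁻¹ * Qk) := by
    rw [cap_eq hD hQ hak h1 h2]
    exact (Matrix.isUnit_iff_isUnit_det _).mpr (Matrix.isUnit_det_of_right_inverse (cap_mul hD hQ hak haL hr))
  have hcapInv : ((-(ak ^ 2) • Gk D Qk ak)⁻¹ + Qkᵀ * ((ak + r) • (1 : Matrix ι ι ℝ) + aL • proj Q)⁻¹ * Qk)⁻¹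
      = -(ak ^ 2) • Gkr D Qk Q ak aL r := by
    rw [cap_eq hD hQ hak h1 h2]
    exact Matrix.inv_eq_right_inv (cap_mul hD hQ hak haL hr)
  unfold Ckr
  rw [ckrInv_eq, Matrix.add_mul_mul_inv_eq_sub _ _ _ _ hA hC hcapU, hcapInv, base_inv_eq_Akr hQ h1 h2]
  rw [Matrix.mul_smul, Matrix.smul_mul, Matrix.smul_mul, neg_smul, sub_neg_eq_add]

/-- `C_{k,r}⁻¹ = Δ_k + aL·QᵀQ + r` is invertible under the same hypotheses (so `C_{k,r}` is a genuine inverse, not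
Lean's junk value). [cite: Dimock2013, §4.2 (one) L2087–2093 (arXiv:1108.1335v2 TeX)] -/
theorem ckrInv_isUnit (hD : D.PosDef) (hQ : Q * Qᵀ = 1) (hak : 0 < ak) (haL : 0 ≤ aL) (hr : 0 ≤ r) :
    IsUnit (Deltak D Qk ak + aL • proj Q + r • (1 : Matrix ι ι ℝ)) := by
  have h1 : ak + r ≠ 0 := by linarith
  have h2 : ak + aL + r ≠ 0 := by linarith
  have hA := base_isUnit (ι := ι) hQ h1 h2
  have hC := mid_isUnit (Qk := Qk) hD hak
  have hcapU : IsUnit ((-(ak ^ 2) • Gk D Qk ak)⁻¹ + Qkᵀ * ((ak + r) • (1 : Matrix ι ι ℝ) + aL • proj Q)⁻¹ * Qk) := by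
    rw [cap_eq hD hQ hak h1 h2]
    exact (Matrix.isUnit_iff_isUnit_det _).mpr (Matrix.isUnit_det_of_right_inverse (cap_mul hD hQ hak haL hr))
  rw [ckrInv_eq]
  obtain ⟨_⟩ := hA.nonempty_invertible
  obtain ⟨_⟩ := hC.nonempty_invertible
  obtain ⟨iAC⟩ := hcapU.nonempty_invertible
  simp only [← Matrix.invOf_eq_nonsing_inv] at iAC
  letI := Matrix.invertibleAddMulMul ((ak + r) • (1 : Matrix ι ι ℝ) + aL • proj Q) Qk (-(ak ^ 2) • Gk D Qk ak) Qkᵀ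
  exact isUnit_of_invertible _

/-- the lemma as the printed pair (one)–(two): `C_{k,r}` inverts `Δ_k + aL·QᵀQ + r` and equals the representation.
[cite: Dimock2013, §4.2 (one)–(two) L2087–2097 (arXiv:1108.1335v2 TeX)] -/
theorem Ckr_mul_eq_one_and_eq (hD : D.PosDef) (hQ : Q * Qᵀ = 1) (hak : 0 < ak) (haL : 0 ≤ aL) (hr : 0 ≤ r) :
    Ckr D Qk Q ak aL r * (Deltak D Qk ak + aL • proj Q + r • (1 : Matrix ι ι ℝ)) = 1 ∧
      Ckr D Qk Q ak aL r
        = Akr Q ak aL r + ak ^ 2 • (Akr Q ak aL r * Qk * Gkr D Qk Q ak aL r * Qkᵀ * Akr Q ak aL r) := by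
  refine ⟨?_, Ckr_eq hD hQ hak haL hr⟩
  unfold Ckr
  exact Matrix.nonsing_inv_mul _ ((Matrix.isUnit_iff_isUnit_det _).mp (ckrInv_isUnit hD hQ hak haL hr))

end Lion

/-! ## §5 Non-vacuity: a one-site instance -/

/-- a `1 × 1` instance of every hypothesis: `D = 1`, `Q_k = Q = 1` (`QQᵀ = I`), `a_k = 1`, `aL = r = 0`; then
`A = 1`, `B = 0`, `G_{k,r} = 1` and the lemma reads `C = 1 + 1 = 2` (indeed `Δ_k = 1 − ½ = ½`, `C = 2`). -/
example : Ckr (1 : Matrix Unit Unit ℝ) (1 : Matrix Unit Unit ℝ) (1 : Matrix Unit Unit ℝ) 1 0 0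
    = Akr (1 : Matrix Unit Unit ℝ) 1 0 0 + (1 : ℝ) ^ 2 • (Akr (1 : Matrix Unit Unit ℝ) 1 0 0 * 1 *
        Gkr (1 : Matrix Unit Unit ℝ) 1 (1 : Matrix Unit Unit ℝ) 1 0 0 * (1 : Matrix Unit Unit ℝ)ᵀ *
        Akr (1 : Matrix Unit Unit ℝ) 1 0 0) :=
  Ckr_eq Matrix.PosDef.one (by simp) one_pos le_rfl le_rfl

/-! ## §6 (v1.1) Lemma 3.5 th2's algebraic input (summer): `a_kQ_kᵀB_{k,r}Q_k` resolved on `Q_kᵀQ_k` and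
`Q_{k+1}ᵀQ_{k+1}`; the sandwich `0 ≤ B_{k,r} ≤ I`; the bracket of `G_{k,r}` between `D` and `D + a_kQ_kᵀQ_k`

[Dimock2013BalabanII] Lemma 3.5 `\label{th2}` proof, TeX L3382–3388, verbatim: *"First note that  a_k Q_kᵀ B_{k,r} Q_k =
(a_k r/(a_k + r)) Q_kᵀQ_k + (a_k²aL^{−2}/((a_k + r)(a_k + aL^{−2} + r))) Q_{k+1}ᵀQ_{k+1}  (summer)  This is bounded below
by O(1)L^{−2} Q_{k+1}ᵀQ_{k+1} for 0 ≤ r ≤ 1 and by O(1) Q_kᵀQ_k for r ≥ 1."*  Here `Q_{k+1} = QQ_k`; the two `O(1)`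
are made explicit (`a_k²aL/((a_k+1)(a_k+aL+1))` with `aL = a/L²`, and `a_k/(a_k+1)`), and the `r`-UNIFORM two-sided
comparison of the bracket `D + a_kQ_kᵀB_{k,r}Q_k` of `G_{k,r}` with the `r = 0` and `r = ∞` brackets is recorded. -/

section Summer

variable {D : Matrix κ κ ℝ} {Qk : Matrix ι κ ℝ} {Q : Matrix σ ι ℝ} {ak aL r : ℝ}

omit [Fintype ι] [DecidableEq σ] in
/-- `B_{k,r} = (r/(a_k+r))·1 + (a_k·aL/((a_k+r)(a_k+aL+r)))·QᵀQ` (collecting the projection). [cite: Dimock2013BalabanII, Lemma th2 proof (summer) (arXiv:1212.5562v2 TeX L3382–3386)] -/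
theorem Bkr_eq_smul_one_add (h1 : ak + r ≠ 0) (h2 : ak + aL + r ≠ 0) :
    Bkr Q ak aL r = (r / (ak + r)) • (1 : Matrix ι ι ℝ) + (ak * aL / ((ak + r) * (ak + aL + r))) • proj Q := by
  have key : (aL + r) / (ak + aL + r) - r / (ak + r) = ak * aL / ((ak + r) * (ak + aL + r)) := by
    field_simp
    ring
  unfold Bkr
  rw [← key, sub_smul, smul_sub]
  abel

omit [Fintype κ] [DecidableEq κ] [DecidableEq σ] in
/-- **(summer)**: `a_kQ_kᵀB_{k,r}Q_k = (a_kr/(a_k+r)) Q_kᵀQ_k + (a_k²aL^{−2}/((a_k+r)(a_k+aL^{−2}+r))) Q_{k+1}ᵀQ_{k+1}` with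
`Q_{k+1} = QQ_k` (`aL` for `aL^{−2}`). [cite: Dimock2013BalabanII, Lemma th2 proof eq. (summer) (arXiv:1212.5562v2 TeX L3382–3386)] -/
theorem smul_conj_Bkr_eq (h1 : ak + r ≠ 0) (h2 : ak + aL + r ≠ 0) :
    ak • (Qkᵀ * Bkr Q ak aL r * Qk)
      = (ak * r / (ak + r)) • (Qkᵀ * Qk)
        + (ak ^ 2 * aL / ((ak + r) * (ak + aL + r))) • ((Q * Qk)ᵀ * (Q * Qk)) := by
  rw [Bkr_eq_smul_one_add h1 h2, Matrix.mul_add, Matrix.add_mul, Matrix.mul_smul, Matrix.mul_one, Matrix.smul_mul,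
    Matrix.mul_smul, Matrix.smul_mul, smul_add, smul_smul, smul_smul, transpose_mul]
  unfold proj
  have e : Qkᵀ * (Qᵀ * Q) * Qk = Qkᵀ * Qᵀ * (Q * Qk) := by simp only [Matrix.mul_assoc]
  rw [e, mul_div_assoc', show ak * (ak * aL / ((ak + r) * (ak + aL + r)))
    = ak ^ 2 * aL / ((ak + r) * (ak + aL + r)) by ring]

/-- **`B_{k,r} ≤ I`**: `I − B_{k,r} = a_kA_{k,r} = (a_k/(a_k+r))(I − QᵀQ) + (a_k/(a_k+aL+r))QᵀQ ≥ 0` (with `B_{k,r} ≥ 0`,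
`Bkr_posSemidef`: the sandwich `0 ≤ B_{k,r} ≤ I`, uniformly in `r ≥ 0`). [cite: Dimock2013BalabanII, App. C (z4) (arXiv:1212.5562v2 TeX L6590–6595); Lemma th2 proof L3382–3388] -/
theorem one_sub_Bkr_posSemidef (hQ : Q * Qᵀ = 1) (hak : 0 < ak) (haL : 0 ≤ aL) (hr : 0 ≤ r) :
    (1 - Bkr Q ak aL r).PosSemidef := by
  have h1 : ak + r ≠ 0 := by linarith
  have h2 : ak + aL + r ≠ 0 := by linarith
  rw [← one_sub_smul_Akr h1 h2, sub_sub_cancel]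
  unfold Akr
  rw [smul_add, smul_smul, smul_smul]
  refine Matrix.PosSemidef.add ?_ ?_
  · exact (compl_posSemidef hQ).smul (mul_nonneg hak.le (inv_nonneg.2 (by linarith)))
  · exact (proj_posSemidef Q).smul (mul_nonneg hak.le (inv_nonneg.2 (by linarith)))

omit [DecidableEq κ] in
/-- **`D ≤ D + a_kQ_kᵀB_{k,r}Q_k`**: the bracket of `G_{k,r}` dominates `D = −Δ + μ̄_k` (from `B_{k,r} ≥ 0`), for every
`r ≥ 0`. [cite: Dimock2013BalabanII, Lemma th2 proof (arXiv:1212.5562v2 TeX L3382–3388); Dimock2013, §4.2 (three) (arXiv:1108.1335v2 TeX L2099–2105)] -/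
theorem gkrInv_sub_posSemidef (hQ : Q * Qᵀ = 1) (hak : 0 < ak) (haL : 0 ≤ aL) (hr : 0 ≤ r) :
    (gkrInv D Qk Q ak aL r - D).PosSemidef := by
  rw [gkrInv_eq (by linarith) (by linarith), add_sub_cancel_left]
  have h := (Bkr_posSemidef hQ hak haL hr).conjTranspose_mul_mul_same Qk
  rw [conjTranspose_eq_transpose_of_trivial] at h
  exact h.smul hak.le

omit [DecidableEq κ] in
/-- **`D + a_kQ_kᵀB_{k,r}Q_k ≤ D + a_kQ_kᵀQ_k`**: the bracket of `G_{k,r}` is dominated by the bracket of `G_k` (from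
`B_{k,r} ≤ I`), for every `r ≥ 0` — with `gkrInv_sub_posSemidef` the `r`-uniform two-sided comparison behind *"for …
all r ≥ 0"* in Lemma th2. [cite: Dimock2013BalabanII, Lemma th2 (arXiv:1212.5562v2 TeX L3365–3388); Dimock2013, §2.2 (arXiv:1108.1335v2 TeX L594–597)] -/
theorem sub_gkrInv_posSemidef (hQ : Q * Qᵀ = 1) (hak : 0 < ak) (haL : 0 ≤ aL) (hr : 0 ≤ r) :
    (D + ak • (Qkᵀ * Qk) - gkrInv D Qk Q ak aL r).PosSemidef := by
  have e : D + ak • (Qkᵀ * Qk) - gkrInv D Qk Q ak aL r = ak • (Qkᵀ * (1 - Bkr Q ak aL r) * Qk) := by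
    rw [gkrInv_eq (by linarith) (by linarith), Matrix.mul_sub, Matrix.sub_mul, Matrix.mul_one, smul_sub]
    abel
  rw [e]
  have h := (one_sub_Bkr_posSemidef hQ hak haL hr).conjTranspose_mul_mul_same Qk
  rw [conjTranspose_eq_transpose_of_trivial] at h
  exact h.smul hak.le

omit [DecidableEq ι] [DecidableEq κ] [DecidableEq σ] in
/-- `MᵀM ≥ 0` for a real matrix. [folklore] -/
private theorem transpose_mul_self_posSemidef {τ : Type*} [Fintype τ] (M : Matrix τ κ ℝ) :
    (Mᵀ * M).PosSemidef := by
  have h := Matrix.posSemidef_conjTranspose_mul_self M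
  rwa [conjTranspose_eq_transpose_of_trivial] at h

omit [DecidableEq κ] [DecidableEq σ] in
/-- **"bounded below by O(1)L^{−2}Q_{k+1}ᵀQ_{k+1} for 0 ≤ r ≤ 1"**, with the `O(1)L^{−2}` explicit:
`a_kQ_kᵀB_{k,r}Q_k ≥ (a_k²aL/((a_k+1)(a_k+aL+1)))·Q_{k+1}ᵀQ_{k+1}` (`aL = a/L²`). [cite: Dimock2013BalabanII, Lemma th2 proof (arXiv:1212.5562v2 TeX L3387–3388)] -/
theorem smul_conj_Bkr_lower_of_le_one (hak : 0 < ak) (haL : 0 ≤ aL) (hr0 : 0 ≤ r) (hr1 : r ≤ 1) :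
    (ak • (Qkᵀ * Bkr Q ak aL r * Qk)
      - (ak ^ 2 * aL / ((ak + 1) * (ak + aL + 1))) • ((Q * Qk)ᵀ * (Q * Qk))).PosSemidef := by
  rw [smul_conj_Bkr_eq (by linarith) (by linarith), add_sub_assoc, ← sub_smul]
  refine Matrix.PosSemidef.add ?_ ?_
  · exact (transpose_mul_self_posSemidef Qk).smul (by positivity)
  · refine (transpose_mul_self_posSemidef (Q * Qk)).smul (sub_nonneg.2 ?_)
    exact div_le_div_of_nonneg_left (by positivity) (by positivity) (by nlinarith)

omit [DecidableEq κ] [DecidableEq σ] in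
/-- **"and by O(1)Q_kᵀQ_k for r ≥ 1"**, with the `O(1)` explicit: `a_kQ_kᵀB_{k,r}Q_k ≥ (a_k/(a_k+1))·Q_kᵀQ_k`. [cite: Dimock2013BalabanII, Lemma th2 proof (arXiv:1212.5562v2 TeX L3387–3388)] -/
theorem smul_conj_Bkr_lower_of_one_le (hak : 0 < ak) (haL : 0 ≤ aL) (hr1 : 1 ≤ r) :
    (ak • (Qkᵀ * Bkr Q ak aL r * Qk) - (ak / (ak + 1)) • (Qkᵀ * Qk)).PosSemidef := by
  rw [smul_conj_Bkr_eq (by linarith) (by linarith), add_sub_right_comm, ← sub_smul]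
  refine Matrix.PosSemidef.add ?_ ?_
  · refine (transpose_mul_self_posSemidef Qk).smul (sub_nonneg.2 ?_)
    rw [div_le_div_iff₀ (by linarith) (by linarith)]
    nlinarith [mul_nonneg (mul_pos hak hak).le (sub_nonneg.2 hr1)]
  · exact (transpose_mul_self_posSemidef (Q * Qk)).smul (by positivity)

end Summer

/-- the one-site instance of (summer): `Q_k = Q = 1`, `a_k = 1`, `aL = 1`, `r = 1` — `B = ½·0 + ⅔·1`, and (summer)
reads `⅔ = ½ + ⅙`. -/
example : (1 : ℝ) • ((1 : Matrix Unit Unit ℝ)ᵀ * Bkr (1 : Matrix Unit Unit ℝ) 1 1 1 * 1)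
    = (1 * 1 / (1 + 1) : ℝ) • ((1 : Matrix Unit Unit ℝ)ᵀ * 1)
      + (1 ^ 2 * 1 / ((1 + 1) * (1 + 1 + 1)) : ℝ) • (((1 : Matrix Unit Unit ℝ) * 1)ᵀ * (1 * 1)) :=
  smul_conj_Bkr_eq (by norm_num) (by norm_num)

end Literature.MathematicalPhysics.QuantumFieldTheory.Dimock2011to13.FluctuationCovarianceIdentity
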